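import Mathlib
import HarnessLib
import Summits.Ventures.LatticeQCDFlow.Exactness.SU2ClosedFormExponential
import Summits.Ventures.LatticeQCDFlow.Exactness.SU2StapleFieldCovariance
import Summits.Ventures.LatticeQCDFlow.Exactness.MatrixExpChart
import Summits.Ventures.LatticeQCDFlow.Scoring.WilsonStapleSum

/-!
# The EXACT (autodiff) gradient of `β·S_W` along the engine's `SU(2)` drift IS the Wilson force routine, with the scale pinned: `κ·∇ = g_(2βcκ)`

HONEST FRAMING: exact (Metropolis-corrected) sampling algorithms for lattice gauge theory;
figures of merit are autocorrelation/cost numbers at stated couplings and volumes; no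
continuum-physics claim.

Venture `LatticeQCDFlow` (cell pub-lqcd), topic `Exactness`; FANOUT row 14 (`eng-flowhmc`, engine
`latflow.fthmc` on the `SU(2)` rung: momenta `p : (Edge × Fin 3) → ℝ`, drift `U_ℓ ← exp(c P_ℓ) U_ℓ`
with `P_ℓ = quatVec (0, p_ℓ)`, forces by autodiff of the action along the drift).  NEW WORK of the
cell; nothing is cited as a fact; no number.  `SU2WilsonForceCovariance` (GEN-10) typed the Wilson
force routine `g_κ V (ℓ, i) = κ · vecQuat (U_ℓ · (quatVec J_ℓ(V))ᴴ) (i+1)` (`J_ℓ` the conjugate staple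
sum of `SU2WilsonFlowLOSubstep`) for EVERY `κ` and listed as NOT CLAIMED "that `g_κ` with a particular
`κ` IS the engine's autodiff output for `β S_W`"; `SU2ExactForceCovariance` typed the exact force
`κ · fderiv ℝ (p ↦ S̃(exp(c p)·V)) 0 (e_q)`.  This file identifies the two for `S̃ = β·S_W`
(identity member), on every torus of side `L ≥ 2`:

* `re_trace_quatVec_mul` — `Re tr (quatVec y · M) = 2 (y₀ m₀ − y₁ m₁ − y₂ m₂ − y₃ m₃)` for a
  quaternion `M` with coordinates `m = vecQuat M` (so `Re tr (E_i M) = −2 mᵢ` for the three units);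
* `conjTranspose_quatVec_stapleJ` — `(quatVec J_(x,μ)(V))ᴴ = R_(x,μ)(V)`, row 16's staple-sum matrix
  `Scoring.stapleSum` in the defining representation (the two books agree);
* `su2Drift_smul_single` — along the coordinate line `p = s·e_(ℓ,i)` the drift is the one-link
  update `Pi.mulSingle ℓ (exp (s · c E_(i+1)))`;
* `differentiableAt_wilsonAction_su2Drift` — `p ↦ β S_W(exp(c p)·V)` IS Fréchet differentiable at
  `p = 0` (each link factor is `NormedSpace.exp` of a linear function of `p`,
  `SU2ClosedFormExponential.coe_su2Drift_eq_exp`; plaquettes are products; no `sqrt` is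
  differentiated), so `fderiv` is the derivative and not a junk value;
* **`su2ExactForce_wilson`** — for `L ≥ 2`, every `β, c, κ` and every field `V`:
  `κ · fderiv ℝ (p ↦ β S_W(exp(c p)·V)) 0 (e_(ℓ,i)) = (2βcκ) · vecQuat (U_ℓ (quatVec J_ℓ)ᴴ) (i+1)`,
  i.e. THE EXACT-GRADIENT FORCE ROUTINE OF `β·S_W` IS THE WILSON ROUTINE `g_(2βcκ)` (as functions of
  the field; row 16's `wilsonAction_mulSingle_sub` supplies `S_W(h ·_ℓ V) − S_W(V)` in staple form);
  **`su2ExactForceRoutine_eq_wilsonForceRoutine`** — the same as an equality of routines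
  `GaugeConfig → momenta`, the form consumed by the kernel theorems.

NOT CLAIMED: the exact force of the PULLED-BACK action `β S_W∘F − log J` of a non-identity member
(it is `F`-dependent and not the Wilson routine); `L = 1`; floating-point autodiff; `SU(N ≥ 3)`;
any number.
-/

noncomputable section

namespace Summit.Ventures.LatticeQCDFlow.Exactness

open WithLp NormedSpace
open Literature.MathematicalPhysics.QuantumFieldTheory Summit.Ventures.LatticeQCDFlow.Scoring
open scoped Matrix Matrix.Norms.Operator

-- The scoped `L∞`-operator normed algebra structure on matrices is only reducibly defeq to the
-- Pi uniformity (as in `MatrixExpChart.lean`).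
set_option backward.isDefEq.respectTransparency false

variable {d L : ℕ}

/-! ## Quaternion bookkeeping -/

section Algebra

/-- `Re tr (quatVec y · M) = 2 (y₀ m₀ − y₁ m₁ − y₂ m₂ − y₃ m₃)` for a quaternion `M`, `m = vecQuat M`. -/
theorem re_trace_quatVec_mul (y : R4) {M : Matrix (Fin 2) (Fin 2) ℂ} (hM : IsQuat M) :
    ((quatVec y * M).trace).re =
      2 * (y 0 * vecQuat M 0 - y 1 * vecQuat M 1 - y 2 * vecQuat M 2 - y 3 * vecQuat M 3) := by
  conv_lhs => rw [← quatVec_vecQuat hM]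
  simp [Matrix.trace_fin_two, Matrix.mul_apply, Fin.sum_univ_two, Complex.mul_re, Complex.mul_im]
  ring

/-- A real multiple of a complex matrix, written with a complex scalar. -/
theorem coe_real_smul_matrix (s : ℝ) (M : Matrix (Fin 2) (Fin 2) ℂ) : (s : ℂ) • M = s • M := by
  ext a b
  simp [Matrix.smul_apply, Complex.real_smul]

/-- `quatVec (0, c·(s a₀), c·(s a₁), c·(s a₂)) = s • quatVec (0, c a₀, c a₁, c a₂)`. -/
theorem quatVec_im_smul (c s a₀ a₁ a₂ : ℝ) :
    quatVec (toLp 2 ![0, c * (s * a₀), c * (s * a₁), c * (s * a₂)]) =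
      s • quatVec (toLp 2 ![0, c * a₀, c * a₁, c * a₂]) := by
  have h : (toLp 2 ![0, c * (s * a₀), c * (s * a₁), c * (s * a₂)] : R4) =
      s • (toLp 2 ![0, c * a₀, c * a₁, c * a₂] : R4) := by
    ext k
    fin_cases k <;> simp <;> ring
  rw [h, quatVec_smul, coe_real_smul_matrix]

/-- `quatVec (0, 0, 0, 0) = 0`, in the drift's letters. -/
theorem quatVec_im_zero (c : ℝ) : quatVec (toLp 2 ![0, c * 0, c * 0, c * 0]) = 0 := by
  have h : (toLp 2 ![0, c * 0, c * 0, c * 0] : R4) = (0 : ℝ) • (toLp 2 ![0, 0, 0, 0] : R4) := by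
    ext k
    fin_cases k <;> simp
  rw [h, quatVec_smul]
  simp

end Algebra

/-! ## The two staple books agree: `(quatVec J_ℓ)ᴴ = R_ℓ` -/

section Staple

/-- **`(quatVec J_(x,μ)(V))ᴴ` is row 16's staple-sum matrix** `Scoring.stapleSum` in the defining
representation: the conjugate staples of `SU2WilsonFlowLOSubstep` are the INVERSES of the staples
`A_ν`, `B_ν` of `Scoring.WilsonStapleSum`, and `(A⁻¹)ᴴ = A` on `SU(2)`. -/
theorem conjTranspose_quatVec_stapleJ (V : GaugeConfig d L (Matrix.specialUnitaryGroup (Fin 2) ℂ)) (x : Site d L) (μ : Fin d) :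
    (quatVec (∑ ν ∈ Finset.univ.erase μ,
            (vecQuat (((V (Site.shift x μ, ν) * (V (Site.shift x ν, μ))⁻¹ * (V (x, ν))⁻¹)⁻¹ : (Matrix.specialUnitaryGroup (Fin 2) ℂ)) : Matrix (Fin 2) (Fin 2) ℂ) +
              vecQuat ((((V (Site.shift (x - Pi.single ν 1) μ, ν))⁻¹ * (V (x - Pi.single ν 1, μ))⁻¹ *
                V (x - Pi.single ν 1, ν))⁻¹ : (Matrix.specialUnitaryGroup (Fin 2) ℂ)) : Matrix (Fin 2) (Fin 2) ℂ))))ᴴ =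
      stapleSum (Matrix.specialUnitaryGroup (Fin 2) ℂ).subtype V x μ := by
  rw [quatVec_sum, Matrix.conjTranspose_sum, stapleSum_def]
  refine Finset.sum_congr rfl fun ν _ => ?_
  rw [quatVec_add, Matrix.conjTranspose_add, quatVec_vecQuat_coe, quatVec_vecQuat_coe]
  simp only [WilsonFlow.coe_inv_SU, Matrix.conjTranspose_conjTranspose, Submonoid.coe_subtype, stapleUp,
    stapleDown]

/-- The force matrix `U_ℓ · R_ℓ` is a quaternion. -/
theorem isQuat_link_mul_stapleSum (V : GaugeConfig d L (Matrix.specialUnitaryGroup (Fin 2) ℂ)) (x : Site d L) (μ : Fin d) :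
    IsQuat ((((V (x, μ)) : (Matrix.specialUnitaryGroup (Fin 2) ℂ)) : Matrix (Fin 2) (Fin 2) ℂ) * stapleSum (Matrix.specialUnitaryGroup (Fin 2) ℂ).subtype V x μ) := by
  refine (IsQuat.of_mem_specialUnitaryGroup (V (x, μ)).2).mul ?_
  rw [stapleSum_def]
  refine IsQuat.sum _ fun ν _ => ?_
  exact (IsQuat.of_mem_specialUnitaryGroup (stapleUp V x μ ν).2).add
    (IsQuat.of_mem_specialUnitaryGroup (stapleDown V x μ ν).2)

end Staple

/-! ## The drift along a coordinate line is a one-link update -/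

section Drift

/-- Momentum `s·e_((x,μ),i)` read at the link `(x, μ)`, component `k`: `s · δ_(k,i)`. -/
theorem smul_single_apply_self (s : ℝ) (ℓ : Edge d L) (i k : Fin 3) :
    (s • (Pi.single (ℓ, i) (1 : ℝ) : ((Edge d L × Fin 3) → ℝ))) (ℓ, k) = s * (Pi.single i (1 : ℝ) : Fin 3 → ℝ) k := by
  rw [Pi.smul_apply, smul_eq_mul]
  by_cases h : k = i
  · subst h
    rw [Pi.single_eq_same, Pi.single_eq_same]
  · rw [Pi.single_eq_of_ne (fun h' => h (Prod.mk.inj h').2), Pi.single_eq_of_ne h]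

/-- Momentum `s·e_((x,μ),i)` vanishes at every other link. -/
theorem smul_single_apply_of_ne (s : ℝ) {ℓ ℓ' : Edge d L} (hℓ : ℓ' ≠ ℓ) (i k : Fin 3) :
    (s • (Pi.single (ℓ, i) (1 : ℝ) : ((Edge d L × Fin 3) → ℝ))) (ℓ', k) = 0 := by
  rw [Pi.smul_apply, Pi.single_eq_of_ne (fun h' => hℓ (Prod.mk.inj h').1), smul_zero]

/-- **Along the coordinate line `p = s·e_(ℓ,i)` the drift is the one-link update
`Pi.mulSingle ℓ (drift factor at ℓ)`** (every other link carries zero momentum: factor `1`). -/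
theorem su2Drift_smul_single (c s : ℝ) (ℓ₀ : Edge d L) (i : Fin 3) :
    (fun ℓ : Edge d L => gaussUnit (toLp 2
          ![Real.cos (c * Real.sqrt ((s • (Pi.single (ℓ₀, i) (1 : ℝ) : ((Edge d L × Fin 3) → ℝ))) (ℓ, 0) ^ 2 + (s • (Pi.single (ℓ₀, i) (1 : ℝ) : ((Edge d L × Fin 3) → ℝ))) (ℓ, 1) ^ 2 + (s • (Pi.single (ℓ₀, i) (1 : ℝ) : ((Edge d L × Fin 3) → ℝ))) (ℓ, 2) ^ 2)),
            c * Real.sinc (c * Real.sqrt ((s • (Pi.single (ℓ₀, i) (1 : ℝ) : ((Edge d L × Fin 3) → ℝ))) (ℓ, 0) ^ 2 + (s • (Pi.single (ℓ₀, i) (1 : ℝ) : ((Edge d L × Fin 3) → ℝ))) (ℓ, 1) ^ 2 + (s • (Pi.single (ℓ₀, i) (1 : ℝ) : ((Edge d L × Fin 3) → ℝ))) (ℓ, 2) ^ 2)) * (s • (Pi.single (ℓ₀, i) (1 : ℝ) : ((Edge d L × Fin 3) → ℝ))) (ℓ, 0),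
            c * Real.sinc (c * Real.sqrt ((s • (Pi.single (ℓ₀, i) (1 : ℝ) : ((Edge d L × Fin 3) → ℝ))) (ℓ, 0) ^ 2 + (s • (Pi.single (ℓ₀, i) (1 : ℝ) : ((Edge d L × Fin 3) → ℝ))) (ℓ, 1) ^ 2 + (s • (Pi.single (ℓ₀, i) (1 : ℝ) : ((Edge d L × Fin 3) → ℝ))) (ℓ, 2) ^ 2)) * (s • (Pi.single (ℓ₀, i) (1 : ℝ) : ((Edge d L × Fin 3) → ℝ))) (ℓ, 1),
            c * Real.sinc (c * Real.sqrt ((s • (Pi.single (ℓ₀, i) (1 : ℝ) : ((Edge d L × Fin 3) → ℝ))) (ℓ, 0) ^ 2 + (s • (Pi.single (ℓ₀, i) (1 : ℝ) : ((Edge d L × Fin 3) → ℝ))) (ℓ, 1) ^ 2 + (s • (Pi.single (ℓ₀, i) (1 : ℝ) : ((Edge d L × Fin 3) → ℝ))) (ℓ, 2) ^ 2)) * (s • (Pi.single (ℓ₀, i) (1 : ℝ) : ((Edge d L × Fin 3) → ℝ))) (ℓ, 2)])) =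
      Pi.mulSingle ℓ₀ (gaussUnit (toLp 2
          ![Real.cos (c * Real.sqrt ((s • (Pi.single (ℓ₀, i) (1 : ℝ) : ((Edge d L × Fin 3) → ℝ))) (ℓ₀, 0) ^ 2 + (s • (Pi.single (ℓ₀, i) (1 : ℝ) : ((Edge d L × Fin 3) → ℝ))) (ℓ₀, 1) ^ 2 + (s • (Pi.single (ℓ₀, i) (1 : ℝ) : ((Edge d L × Fin 3) → ℝ))) (ℓ₀, 2) ^ 2)),
            c * Real.sinc (c * Real.sqrt ((s • (Pi.single (ℓ₀, i) (1 : ℝ) : ((Edge d L × Fin 3) → ℝ))) (ℓ₀, 0) ^ 2 + (s • (Pi.single (ℓ₀, i) (1 : ℝ) : ((Edge d L × Fin 3) → ℝ))) (ℓ₀, 1) ^ 2 + (s • (Pi.single (ℓ₀, i) (1 : ℝ) : ((Edge d L × Fin 3) → ℝ))) (ℓ₀, 2) ^ 2)) * (s • (Pi.single (ℓ₀, i) (1 : ℝ) : ((Edge d L × Fin 3) → ℝ))) (ℓ₀, 0),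
            c * Real.sinc (c * Real.sqrt ((s • (Pi.single (ℓ₀, i) (1 : ℝ) : ((Edge d L × Fin 3) → ℝ))) (ℓ₀, 0) ^ 2 + (s • (Pi.single (ℓ₀, i) (1 : ℝ) : ((Edge d L × Fin 3) → ℝ))) (ℓ₀, 1) ^ 2 + (s • (Pi.single (ℓ₀, i) (1 : ℝ) : ((Edge d L × Fin 3) → ℝ))) (ℓ₀, 2) ^ 2)) * (s • (Pi.single (ℓ₀, i) (1 : ℝ) : ((Edge d L × Fin 3) → ℝ))) (ℓ₀, 1),
            c * Real.sinc (c * Real.sqrt ((s • (Pi.single (ℓ₀, i) (1 : ℝ) : ((Edge d L × Fin 3) → ℝ))) (ℓ₀, 0) ^ 2 + (s • (Pi.single (ℓ₀, i) (1 : ℝ) : ((Edge d L × Fin 3) → ℝ))) (ℓ₀, 1) ^ 2 + (s • (Pi.single (ℓ₀, i) (1 : ℝ) : ((Edge d L × Fin 3) → ℝ))) (ℓ₀, 2) ^ 2)) * (s • (Pi.single (ℓ₀, i) (1 : ℝ) : ((Edge d L × Fin 3) → ℝ))) (ℓ₀, 2)])) := by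
  funext ℓ'
  by_cases hℓ : ℓ' = ℓ₀
  · subst hℓ
    rw [Pi.mulSingle_eq_same]
  · rw [Pi.mulSingle_eq_of_ne hℓ]
    apply Subtype.ext
    rw [coe_su2Drift_eq_exp c (s • (Pi.single (ℓ₀, i) (1 : ℝ) : ((Edge d L × Fin 3) → ℝ))) ℓ']
    rw [smul_single_apply_of_ne s hℓ i 0, smul_single_apply_of_ne s hℓ i 1, smul_single_apply_of_ne s hℓ i 2,
      quatVec_im_zero, NormedSpace.exp_zero]
    rfl

/-- The drift factor at the link itself, as a matrix: `exp (s • X)` with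
`X = quatVec (0, c δ_(0,i), c δ_(1,i), c δ_(2,i)) = c E_(i+1)`. -/
theorem coe_su2DriftAt_smul_single (c s : ℝ) (ℓ : Edge d L) (i : Fin 3) :
    ((gaussUnit (toLp 2
          ![Real.cos (c * Real.sqrt ((s • (Pi.single (ℓ, i) (1 : ℝ) : ((Edge d L × Fin 3) → ℝ))) (ℓ, 0) ^ 2 + (s • (Pi.single (ℓ, i) (1 : ℝ) : ((Edge d L × Fin 3) → ℝ))) (ℓ, 1) ^ 2 + (s • (Pi.single (ℓ, i) (1 : ℝ) : ((Edge d L × Fin 3) → ℝ))) (ℓ, 2) ^ 2)),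
            c * Real.sinc (c * Real.sqrt ((s • (Pi.single (ℓ, i) (1 : ℝ) : ((Edge d L × Fin 3) → ℝ))) (ℓ, 0) ^ 2 + (s • (Pi.single (ℓ, i) (1 : ℝ) : ((Edge d L × Fin 3) → ℝ))) (ℓ, 1) ^ 2 + (s • (Pi.single (ℓ, i) (1 : ℝ) : ((Edge d L × Fin 3) → ℝ))) (ℓ, 2) ^ 2)) * (s • (Pi.single (ℓ, i) (1 : ℝ) : ((Edge d L × Fin 3) → ℝ))) (ℓ, 0),
            c * Real.sinc (c * Real.sqrt ((s • (Pi.single (ℓ, i) (1 : ℝ) : ((Edge d L × Fin 3) → ℝ))) (ℓ, 0) ^ 2 + (s • (Pi.single (ℓ, i) (1 : ℝ) : ((Edge d L × Fin 3) → ℝ))) (ℓ, 1) ^ 2 + (s • (Pi.single (ℓ, i) (1 : ℝ) : ((Edge d L × Fin 3) → ℝ))) (ℓ, 2) ^ 2)) * (s • (Pi.single (ℓ, i) (1 : ℝ) : ((Edge d L × Fin 3) → ℝ))) (ℓ, 1),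
            c * Real.sinc (c * Real.sqrt ((s • (Pi.single (ℓ, i) (1 : ℝ) : ((Edge d L × Fin 3) → ℝ))) (ℓ, 0) ^ 2 + (s • (Pi.single (ℓ, i) (1 : ℝ) : ((Edge d L × Fin 3) → ℝ))) (ℓ, 1) ^ 2 + (s • (Pi.single (ℓ, i) (1 : ℝ) : ((Edge d L × Fin 3) → ℝ))) (ℓ, 2) ^ 2)) * (s • (Pi.single (ℓ, i) (1 : ℝ) : ((Edge d L × Fin 3) → ℝ))) (ℓ, 2)]) : (Matrix.specialUnitaryGroup (Fin 2) ℂ)) : Matrix (Fin 2) (Fin 2) ℂ) =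
      exp (s • quatVec (toLp 2 ![0, c * (Pi.single i (1 : ℝ) : Fin 3 → ℝ) 0,
        c * (Pi.single i (1 : ℝ) : Fin 3 → ℝ) 1, c * (Pi.single i (1 : ℝ) : Fin 3 → ℝ) 2])) := by
  rw [coe_su2Drift_eq_exp c (s • (Pi.single (ℓ, i) (1 : ℝ) : ((Edge d L × Fin 3) → ℝ))) ℓ, smul_single_apply_self,
    smul_single_apply_self, smul_single_apply_self, quatVec_im_smul]

end Drift

/-! ## Differentiability of the action along the drift -/

section Smooth

variable [NeZero L]

/-- Each drift factor `p ↦ exp (quatVec (0, c p_ℓ))` is differentiable (a matrix exponential of a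
linear function of `p`). -/
theorem differentiableAt_su2DriftCoe (c : ℝ) (ℓ : Edge d L) (p₀ : ((Edge d L × Fin 3) → ℝ)) :
    DifferentiableAt ℝ (fun p : ((Edge d L × Fin 3) → ℝ) => exp (quatVec (toLp 2 ![0, c * p (ℓ, 0), c * p (ℓ, 1), c * p (ℓ, 2)]))) p₀ := by
  -- the exponent is an `ℝ`-linear map of `p`
  let Ψ : ((Edge d L × Fin 3) → ℝ) →ₗ[ℝ] Matrix (Fin 2) (Fin 2) ℂ :=
    { toFun := fun p => quatVec (toLp 2 ![0, c * p (ℓ, 0), c * p (ℓ, 1), c * p (ℓ, 2)]),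
      map_add' := fun p p' => by
        rw [← quatVec_add]
        congr 1
        ext k
        fin_cases k <;> simp [mul_add]
      map_smul' := fun r p => by
        rw [RingHom.id_apply, ← coe_real_smul_matrix, ← quatVec_smul]
        congr 1
        ext k
        fin_cases k <;> simp <;> ring }
  have hΨ : DifferentiableAt ℝ (fun p : ((Edge d L × Fin 3) → ℝ) => quatVec (toLp 2 ![0, c * p (ℓ, 0), c * p (ℓ, 1), c * p (ℓ, 2)])) p₀ :=
    (LinearMap.toContinuousLinearMap Ψ).differentiableAt
  exact ((contDiffAt_matrixExp _).differentiableAt (by simp)).comp p₀ hΨ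

/-- Each link of the drifted field, as a matrix, is a differentiable function of the momenta. -/
theorem differentiableAt_su2Drift_link (c : ℝ) (V : GaugeConfig d L (Matrix.specialUnitaryGroup (Fin 2) ℂ)) (ℓ' : Edge d L) (p₀ : ((Edge d L × Fin 3) → ℝ)) :
    DifferentiableAt ℝ (fun p : ((Edge d L × Fin 3) → ℝ) => ((((fun ℓ : Edge d L => gaussUnit (toLp 2
          ![Real.cos (c * Real.sqrt (p (ℓ, 0) ^ 2 + p (ℓ, 1) ^ 2 + p (ℓ, 2) ^ 2)),
            c * Real.sinc (c * Real.sqrt (p (ℓ, 0) ^ 2 + p (ℓ, 1) ^ 2 + p (ℓ, 2) ^ 2)) * p (ℓ, 0),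
            c * Real.sinc (c * Real.sqrt (p (ℓ, 0) ^ 2 + p (ℓ, 1) ^ 2 + p (ℓ, 2) ^ 2)) * p (ℓ, 1),
            c * Real.sinc (c * Real.sqrt (p (ℓ, 0) ^ 2 + p (ℓ, 1) ^ 2 + p (ℓ, 2) ^ 2)) * p (ℓ, 2)])) * V) ℓ' : (Matrix.specialUnitaryGroup (Fin 2) ℂ)) : Matrix (Fin 2) (Fin 2) ℂ)) p₀ := by
  simp only [Pi.mul_apply, WilsonFlow.coe_mul_SU, coe_su2Drift_eq_exp]
  exact (differentiableAt_su2DriftCoe c ℓ' p₀).mul_const _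

/-- **`p ↦ β·S_W(exp(c p)·V)` is Fréchet differentiable** (everywhere, in particular at `p = 0`). -/
theorem differentiableAt_wilsonAction_su2Drift (β c : ℝ) (V : GaugeConfig d L (Matrix.specialUnitaryGroup (Fin 2) ℂ)) (p₀ : ((Edge d L × Fin 3) → ℝ)) :
    DifferentiableAt ℝ (fun p : ((Edge d L × Fin 3) → ℝ) => (fun W : GaugeConfig d L (Matrix.specialUnitaryGroup (Fin 2) ℂ) => β * wilsonAction (Matrix.specialUnitaryGroup (Fin 2) ℂ).subtype W) ((fun ℓ : Edge d L => gaussUnit (toLp 2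
          ![Real.cos (c * Real.sqrt (p (ℓ, 0) ^ 2 + p (ℓ, 1) ^ 2 + p (ℓ, 2) ^ 2)),
            c * Real.sinc (c * Real.sqrt (p (ℓ, 0) ^ 2 + p (ℓ, 1) ^ 2 + p (ℓ, 2) ^ 2)) * p (ℓ, 0),
            c * Real.sinc (c * Real.sqrt (p (ℓ, 0) ^ 2 + p (ℓ, 1) ^ 2 + p (ℓ, 2) ^ 2)) * p (ℓ, 1),
            c * Real.sinc (c * Real.sqrt (p (ℓ, 0) ^ 2 + p (ℓ, 1) ^ 2 + p (ℓ, 2) ^ 2)) * p (ℓ, 2)])) * V)) p₀ := by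
  -- conjugate transposition and `Re tr` as continuous `ℝ`-linear maps
  let CT : Matrix (Fin 2) (Fin 2) ℂ →ₗ[ℝ] Matrix (Fin 2) (Fin 2) ℂ :=
    { toFun := fun W => Wᴴ,
      map_add' := fun A B => Matrix.conjTranspose_add A B,
      map_smul' := fun r A => by rw [Matrix.conjTranspose_smul, RingHom.id_apply, star_trivial] }
  have hCT : Differentiable ℝ (fun W : Matrix (Fin 2) (Fin 2) ℂ => Wᴴ) := (LinearMap.toContinuousLinearMap CT).differentiable
  let TR : Matrix (Fin 2) (Fin 2) ℂ →ₗ[ℝ] ℝ :=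
    { toFun := fun W => (W.trace).re,
      map_add' := fun A B => by simp only [Matrix.trace_add, Complex.add_re],
      map_smul' := fun r A => by
        simp only [Matrix.trace_smul, RingHom.id_apply, Complex.real_smul, Complex.mul_re,
          Complex.ofReal_re, Complex.ofReal_im, zero_mul, sub_zero, smul_eq_mul] }
  have hTR : Differentiable ℝ (fun W : Matrix (Fin 2) (Fin 2) ℂ => (W.trace).re) := (LinearMap.toContinuousLinearMap TR).differentiable
  have hlink := differentiableAt_su2Drift_link c V
  have hhol : ∀ (x : Site d L) (μ ν : Fin d), DifferentiableAt ℝ (fun p : ((Edge d L × Fin 3) → ℝ) =>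
      (((plaquetteHolonomy ((fun ℓ : Edge d L => gaussUnit (toLp 2
          ![Real.cos (c * Real.sqrt (p (ℓ, 0) ^ 2 + p (ℓ, 1) ^ 2 + p (ℓ, 2) ^ 2)),
            c * Real.sinc (c * Real.sqrt (p (ℓ, 0) ^ 2 + p (ℓ, 1) ^ 2 + p (ℓ, 2) ^ 2)) * p (ℓ, 0),
            c * Real.sinc (c * Real.sqrt (p (ℓ, 0) ^ 2 + p (ℓ, 1) ^ 2 + p (ℓ, 2) ^ 2)) * p (ℓ, 1),
            c * Real.sinc (c * Real.sqrt (p (ℓ, 0) ^ 2 + p (ℓ, 1) ^ 2 + p (ℓ, 2) ^ 2)) * p (ℓ, 2)])) * V) x μ ν) : (Matrix.specialUnitaryGroup (Fin 2) ℂ)) : Matrix (Fin 2) (Fin 2) ℂ)) p₀ := by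
    intro x μ ν
    simp only [plaquetteHolonomy, WilsonFlow.coe_mul_SU, WilsonFlow.coe_inv_SU]
    exact (((hlink _ p₀).mul (hlink _ p₀)).mul ((hCT.differentiableAt).comp p₀ (hlink _ p₀))).mul
      ((hCT.differentiableAt).comp p₀ (hlink _ p₀))
  beta_reduce
  unfold wilsonAction
  refine DifferentiableAt.const_mul ?_ β
  refine DifferentiableAt.fun_sum fun pl _ => ?_
  refine DifferentiableAt.const_sub ?_ _
  simp only [Submonoid.coe_subtype]
  exact (hTR.differentiableAt).comp p₀ (hhol pl.1 pl.2.1.1 pl.2.1.2)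

end Smooth

/-! ## The exact gradient of `β·S_W` is the Wilson routine with `κ' = 2βcκ` -/

section Main

variable [NeZero L]

/-- **THE EXACT (autodiff) FORCE OF `β·S_W` ALONG THE DRIFT IS THE WILSON FORCE ROUTINE `g_(2βcκ)`.**
For `L ≥ 2`, every `β, c, κ`, every field `V` and every momentum coordinate `(ℓ, i)`:
`κ · fderiv ℝ (p ↦ β S_W(exp(c p)·V)) 0 (e_(ℓ,i)) = (2βcκ) · vecQuat (U_ℓ (quatVec J_ℓ(V))ᴴ) (i+1)`. -/
theorem su2ExactForce_wilson (hL : 2 ≤ L) (β c κ : ℝ) (V : GaugeConfig d L (Matrix.specialUnitaryGroup (Fin 2) ℂ)) :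
    (fun q : Edge d L × Fin 3 => κ * fderiv ℝ (fun p : ((Edge d L × Fin 3) → ℝ) => (fun W : GaugeConfig d L (Matrix.specialUnitaryGroup (Fin 2) ℂ) => β * wilsonAction (Matrix.specialUnitaryGroup (Fin 2) ℂ).subtype W) ((fun ℓ : Edge d L => gaussUnit (toLp 2
          ![Real.cos (c * Real.sqrt (p (ℓ, 0) ^ 2 + p (ℓ, 1) ^ 2 + p (ℓ, 2) ^ 2)),
            c * Real.sinc (c * Real.sqrt (p (ℓ, 0) ^ 2 + p (ℓ, 1) ^ 2 + p (ℓ, 2) ^ 2)) * p (ℓ, 0),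
            c * Real.sinc (c * Real.sqrt (p (ℓ, 0) ^ 2 + p (ℓ, 1) ^ 2 + p (ℓ, 2) ^ 2)) * p (ℓ, 1),
            c * Real.sinc (c * Real.sqrt (p (ℓ, 0) ^ 2 + p (ℓ, 1) ^ 2 + p (ℓ, 2) ^ 2)) * p (ℓ, 2)])) * V)) 0 (Pi.single q 1)) =
      (fun q : Edge d L × Fin 3 => (2 * β * c * κ) * vecQuat (((V q.1 : Matrix.specialUnitaryGroup (Fin 2) ℂ) : Matrix (Fin 2) (Fin 2) ℂ) * (quatVec (∑ ν ∈ Finset.univ.erase q.1.2,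
            (vecQuat (((V (Site.shift q.1.1 q.1.2, ν) * (V (Site.shift q.1.1 ν, q.1.2))⁻¹ * (V (q.1.1, ν))⁻¹)⁻¹ : (Matrix.specialUnitaryGroup (Fin 2) ℂ)) : Matrix (Fin 2) (Fin 2) ℂ) +
              vecQuat ((((V (Site.shift (q.1.1 - Pi.single ν 1) q.1.2, ν))⁻¹ * (V (q.1.1 - Pi.single ν 1, q.1.2))⁻¹ *
                V (q.1.1 - Pi.single ν 1, ν))⁻¹ : (Matrix.specialUnitaryGroup (Fin 2) ℂ)) : Matrix (Fin 2) (Fin 2) ℂ))))ᴴ) q.2.succ) := by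
  funext q
  obtain ⟨ℓ, i⟩ := q
  obtain ⟨x, μ⟩ := ℓ
  have hρ : Continuous ⇑((Matrix.specialUnitaryGroup (Fin 2) ℂ).subtype) := continuous_subtype_val
  -- the action along the drift and its differentiability at `p = 0`
  set f : ((Edge d L × Fin 3) → ℝ) → ℝ := fun p : ((Edge d L × Fin 3) → ℝ) => (fun W : GaugeConfig d L (Matrix.specialUnitaryGroup (Fin 2) ℂ) => β * wilsonAction (Matrix.specialUnitaryGroup (Fin 2) ℂ).subtype W) ((fun ℓ : Edge d L => gaussUnit (toLp 2
          ![Real.cos (c * Real.sqrt (p (ℓ, 0) ^ 2 + p (ℓ, 1) ^ 2 + p (ℓ, 2) ^ 2)),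
            c * Real.sinc (c * Real.sqrt (p (ℓ, 0) ^ 2 + p (ℓ, 1) ^ 2 + p (ℓ, 2) ^ 2)) * p (ℓ, 0),
            c * Real.sinc (c * Real.sqrt (p (ℓ, 0) ^ 2 + p (ℓ, 1) ^ 2 + p (ℓ, 2) ^ 2)) * p (ℓ, 1),
            c * Real.sinc (c * Real.sqrt (p (ℓ, 0) ^ 2 + p (ℓ, 1) ^ 2 + p (ℓ, 2) ^ 2)) * p (ℓ, 2)])) * V) with hf_def
  have hdiff : DifferentiableAt ℝ f 0 := differentiableAt_wilsonAction_su2Drift β c V 0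
  -- abbreviations: the coordinate direction, the generator, the staple sum, the force matrix
  set v : ((Edge d L × Fin 3) → ℝ) := Pi.single ((x, μ), i) (1 : ℝ) with hv_def
  set X : Matrix (Fin 2) (Fin 2) ℂ := quatVec (toLp 2 ![0, c * (Pi.single i (1 : ℝ) : Fin 3 → ℝ) 0,
    c * (Pi.single i (1 : ℝ) : Fin 3 → ℝ) 1, c * (Pi.single i (1 : ℝ) : Fin 3 → ℝ) 2]) with hX_def
  set R : Matrix (Fin 2) (Fin 2) ℂ := stapleSum (Matrix.specialUnitaryGroup (Fin 2) ℂ).subtype V x μ with hR_def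
  set M : Matrix (Fin 2) (Fin 2) ℂ := (((V (x, μ)) : (Matrix.specialUnitaryGroup (Fin 2) ℂ)) : Matrix (Fin 2) (Fin 2) ℂ) * R with hM_def
  -- (1) the action along the coordinate line, by row 16's staple form of the local action change
  have hline : ∀ s : ℝ, f (s • v) =
      β * ((wilsonAction (Matrix.specialUnitaryGroup (Fin 2) ℂ).subtype V + (M.trace).re) - ((exp (s • X) * M).trace).re) := by
    intro s
    have hsub := wilsonAction_mulSingle_sub (Matrix.specialUnitaryGroup (Fin 2) ℂ).subtype hL hρ V x μ
      (gaussUnit (toLp 2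
          ![Real.cos (c * Real.sqrt ((s • (Pi.single ((x, μ), i) (1 : ℝ) : ((Edge d L × Fin 3) → ℝ))) ((x, μ), 0) ^ 2 + (s • (Pi.single ((x, μ), i) (1 : ℝ) : ((Edge d L × Fin 3) → ℝ))) ((x, μ), 1) ^ 2 + (s • (Pi.single ((x, μ), i) (1 : ℝ) : ((Edge d L × Fin 3) → ℝ))) ((x, μ), 2) ^ 2)),
            c * Real.sinc (c * Real.sqrt ((s • (Pi.single ((x, μ), i) (1 : ℝ) : ((Edge d L × Fin 3) → ℝ))) ((x, μ), 0) ^ 2 + (s • (Pi.single ((x, μ), i) (1 : ℝ) : ((Edge d L × Fin 3) → ℝ))) ((x, μ), 1) ^ 2 + (s • (Pi.single ((x, μ), i) (1 : ℝ) : ((Edge d L × Fin 3) → ℝ))) ((x, μ), 2) ^ 2)) * (s • (Pi.single ((x, μ), i) (1 : ℝ) : ((Edge d L × Fin 3) → ℝ))) ((x, μ), 0),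
            c * Real.sinc (c * Real.sqrt ((s • (Pi.single ((x, μ), i) (1 : ℝ) : ((Edge d L × Fin 3) → ℝ))) ((x, μ), 0) ^ 2 + (s • (Pi.single ((x, μ), i) (1 : ℝ) : ((Edge d L × Fin 3) → ℝ))) ((x, μ), 1) ^ 2 + (s • (Pi.single ((x, μ), i) (1 : ℝ) : ((Edge d L × Fin 3) → ℝ))) ((x, μ), 2) ^ 2)) * (s • (Pi.single ((x, μ), i) (1 : ℝ) : ((Edge d L × Fin 3) → ℝ))) ((x, μ), 1),
            c * Real.sinc (c * Real.sqrt ((s • (Pi.single ((x, μ), i) (1 : ℝ) : ((Edge d L × Fin 3) → ℝ))) ((x, μ), 0) ^ 2 + (s • (Pi.single ((x, μ), i) (1 : ℝ) : ((Edge d L × Fin 3) → ℝ))) ((x, μ), 1) ^ 2 + (s • (Pi.single ((x, μ), i) (1 : ℝ) : ((Edge d L × Fin 3) → ℝ))) ((x, μ), 2) ^ 2)) * (s • (Pi.single ((x, μ), i) (1 : ℝ) : ((Edge d L × Fin 3) → ℝ))) ((x, μ), 2)]))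
    rw [hf_def, hv_def]
    beta_reduce
    rw [su2Drift_smul_single c s (x, μ) i]
    have hW : wilsonAction (Matrix.specialUnitaryGroup (Fin 2) ℂ).subtype (Pi.mulSingle (x, μ) (gaussUnit (toLp 2
          ![Real.cos (c * Real.sqrt ((s • (Pi.single ((x, μ), i) (1 : ℝ) : ((Edge d L × Fin 3) → ℝ))) ((x, μ), 0) ^ 2 + (s • (Pi.single ((x, μ), i) (1 : ℝ) : ((Edge d L × Fin 3) → ℝ))) ((x, μ), 1) ^ 2 + (s • (Pi.single ((x, μ), i) (1 : ℝ) : ((Edge d L × Fin 3) → ℝ))) ((x, μ), 2) ^ 2)),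
            c * Real.sinc (c * Real.sqrt ((s • (Pi.single ((x, μ), i) (1 : ℝ) : ((Edge d L × Fin 3) → ℝ))) ((x, μ), 0) ^ 2 + (s • (Pi.single ((x, μ), i) (1 : ℝ) : ((Edge d L × Fin 3) → ℝ))) ((x, μ), 1) ^ 2 + (s • (Pi.single ((x, μ), i) (1 : ℝ) : ((Edge d L × Fin 3) → ℝ))) ((x, μ), 2) ^ 2)) * (s • (Pi.single ((x, μ), i) (1 : ℝ) : ((Edge d L × Fin 3) → ℝ))) ((x, μ), 0),
            c * Real.sinc (c * Real.sqrt ((s • (Pi.single ((x, μ), i) (1 : ℝ) : ((Edge d L × Fin 3) → ℝ))) ((x, μ), 0) ^ 2 + (s • (Pi.single ((x, μ), i) (1 : ℝ) : ((Edge d L × Fin 3) → ℝ))) ((x, μ), 1) ^ 2 + (s • (Pi.single ((x, μ), i) (1 : ℝ) : ((Edge d L × Fin 3) → ℝ))) ((x, μ), 2) ^ 2)) * (s • (Pi.single ((x, μ), i) (1 : ℝ) : ((Edge d L × Fin 3) → ℝ))) ((x, μ), 1),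
            c * Real.sinc (c * Real.sqrt ((s • (Pi.single ((x, μ), i) (1 : ℝ) : ((Edge d L × Fin 3) → ℝ))) ((x, μ), 0) ^ 2 + (s • (Pi.single ((x, μ), i) (1 : ℝ) : ((Edge d L × Fin 3) → ℝ))) ((x, μ), 1) ^ 2 + (s • (Pi.single ((x, μ), i) (1 : ℝ) : ((Edge d L × Fin 3) → ℝ))) ((x, μ), 2) ^ 2)) * (s • (Pi.single ((x, μ), i) (1 : ℝ) : ((Edge d L × Fin 3) → ℝ))) ((x, μ), 2)])) * V) =
        wilsonAction (Matrix.specialUnitaryGroup (Fin 2) ℂ).subtype V + (M.trace).re - ((exp (s • X) * M).trace).re := by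
      rw [sub_eq_iff_eq_add'.mp hsub]
      simp only [Submonoid.coe_subtype, Submonoid.coe_mul, coe_su2DriftAt_smul_single, hM_def, hR_def, hX_def,
        Matrix.mul_assoc]
      ring
    rw [hW]
  -- (2) its derivative at `s = 0`
  have hexp : HasDerivAt (fun s : ℝ => exp (s • X)) X 0 := by
    have h := hasDerivAt_exp_smul_const' (𝕂 := ℝ) X (0 : ℝ)
    rwa [zero_smul, NormedSpace.exp_zero, mul_one] at h
  let TR : Matrix (Fin 2) (Fin 2) ℂ →ₗ[ℝ] ℝ :=
    { toFun := fun W => (W.trace).re,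
      map_add' := fun A B => by simp only [Matrix.trace_add, Complex.add_re],
      map_smul' := fun r A => by
        simp only [Matrix.trace_smul, RingHom.id_apply, Complex.real_smul, Complex.mul_re,
          Complex.ofReal_re, Complex.ofReal_im, zero_mul, sub_zero, smul_eq_mul] }
  have htr : HasDerivAt (fun s : ℝ => ((exp (s • X) * M).trace).re) (((X * M).trace).re) 0 :=
    (LinearMap.toContinuousLinearMap TR).hasFDerivAt.comp_hasDerivAt 0 (hexp.mul_const M)
  have hg : HasDerivAt (fun s : ℝ => f (s • v)) (β * -(((X * M).trace).re)) 0 := by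
    have h := (htr.const_sub (wilsonAction (Matrix.specialUnitaryGroup (Fin 2) ℂ).subtype V + (M.trace).re)).const_mul β
    refine HasDerivAt.congr_of_eventuallyEq h (Filter.Eventually.of_forall fun s => ?_)
    exact hline s
  -- (3) the same derivative through `fderiv` (the action IS differentiable at `0`)
  have hcurve : HasDerivAt (fun s : ℝ => f (s • v)) (fderiv ℝ f 0 v) 0 := by
    have h0 : HasFDerivAt f (fderiv ℝ f 0) ((0 : ℝ) • v) := by
      rw [zero_smul]
      exact hdiff.hasFDerivAt
    have h1 : HasDerivAt (fun s : ℝ => s • v) ((1 : ℝ) • v) 0 := (hasDerivAt_id (0 : ℝ)).smul_const v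
    have h2 := h0.comp_hasDerivAt (0 : ℝ) h1
    rw [one_smul] at h2
    exact h2
  have hval : fderiv ℝ f 0 v = β * -(((X * M).trace).re) := hcurve.unique hg
  -- (4) the quaternion algebra: `Re tr (X M) = −2c · m_(i+1)`
  have hM : IsQuat M := isQuat_link_mul_stapleSum V x μ
  have htrace : ((X * M).trace).re = -2 * c * vecQuat M i.succ := by
    rw [hX_def, re_trace_quatVec_mul _ hM]
    fin_cases i <;> simp <;> ring
  -- assemble
  show κ * fderiv ℝ f 0 v = (2 * β * c * κ) * vecQuat ((((V (x, μ)) : (Matrix.specialUnitaryGroup (Fin 2) ℂ)) : Matrix (Fin 2) (Fin 2) ℂ) *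
    (quatVec (∑ ν ∈ Finset.univ.erase μ,
            (vecQuat (((V (Site.shift x μ, ν) * (V (Site.shift x ν, μ))⁻¹ * (V (x, ν))⁻¹)⁻¹ : (Matrix.specialUnitaryGroup (Fin 2) ℂ)) : Matrix (Fin 2) (Fin 2) ℂ) +
              vecQuat ((((V (Site.shift (x - Pi.single ν 1) μ, ν))⁻¹ * (V (x - Pi.single ν 1, μ))⁻¹ *
                V (x - Pi.single ν 1, ν))⁻¹ : (Matrix.specialUnitaryGroup (Fin 2) ℂ)) : Matrix (Fin 2) (Fin 2) ℂ))))ᴴ) i.succ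
  rw [hval, htrace, conjTranspose_quatVec_stapleJ V x μ, ← hR_def, ← hM_def]
  ring

/-- **The exact-gradient force routine of `β·S_W` IS the Wilson routine `g_(2βcκ)`**, as routines
`GaugeConfig → momenta` (the form the kernel theorems consume: e.g. the HMC kernel of
`SU2WilsonForceCovariance.su2_hmc_wilsonForce_conjKernel_gaugeTransform` with `κ' = 2βcκ` IS the
kernel driven by the autodiff gradient of `β·S_W`). -/
theorem su2ExactForceRoutine_eq_wilsonForceRoutine (hL : 2 ≤ L) (β c κ : ℝ) :
    (fun V : GaugeConfig d L (Matrix.specialUnitaryGroup (Fin 2) ℂ) => (fun q : Edge d L × Fin 3 => κ * fderiv ℝ (fun p : ((Edge d L × Fin 3) → ℝ) => (fun W : GaugeConfig d L (Matrix.specialUnitaryGroup (Fin 2) ℂ) => β * wilsonAction (Matrix.specialUnitaryGroup (Fin 2) ℂ).subtype W) ((fun ℓ : Edge d L => gaussUnit (toLp 2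
          ![Real.cos (c * Real.sqrt (p (ℓ, 0) ^ 2 + p (ℓ, 1) ^ 2 + p (ℓ, 2) ^ 2)),
            c * Real.sinc (c * Real.sqrt (p (ℓ, 0) ^ 2 + p (ℓ, 1) ^ 2 + p (ℓ, 2) ^ 2)) * p (ℓ, 0),
            c * Real.sinc (c * Real.sqrt (p (ℓ, 0) ^ 2 + p (ℓ, 1) ^ 2 + p (ℓ, 2) ^ 2)) * p (ℓ, 1),
            c * Real.sinc (c * Real.sqrt (p (ℓ, 0) ^ 2 + p (ℓ, 1) ^ 2 + p (ℓ, 2) ^ 2)) * p (ℓ, 2)])) * V)) 0 (Pi.single q 1))) =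
      (fun V : GaugeConfig d L (Matrix.specialUnitaryGroup (Fin 2) ℂ) => (fun q : Edge d L × Fin 3 => (2 * β * c * κ) * vecQuat (((V q.1 : Matrix.specialUnitaryGroup (Fin 2) ℂ) : Matrix (Fin 2) (Fin 2) ℂ) * (quatVec (∑ ν ∈ Finset.univ.erase q.1.2,
            (vecQuat (((V (Site.shift q.1.1 q.1.2, ν) * (V (Site.shift q.1.1 ν, q.1.2))⁻¹ * (V (q.1.1, ν))⁻¹)⁻¹ : (Matrix.specialUnitaryGroup (Fin 2) ℂ)) : Matrix (Fin 2) (Fin 2) ℂ) +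
              vecQuat ((((V (Site.shift (q.1.1 - Pi.single ν 1) q.1.2, ν))⁻¹ * (V (q.1.1 - Pi.single ν 1, q.1.2))⁻¹ *
                V (q.1.1 - Pi.single ν 1, ν))⁻¹ : (Matrix.specialUnitaryGroup (Fin 2) ℂ)) : Matrix (Fin 2) (Fin 2) ℂ))))ᴴ) q.2.succ)) :=
  funext fun V => su2ExactForce_wilson hL β c κ V

end Main

end Summit.Ventures.LatticeQCDFlow.Exactness
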